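import Summits.AtomisticToContinuum.HydrodynamicLimit.Theses.OneFlightGossipEngine
import Literature.MathematicalPhysics.KineticTheory.HardSphereEulerLLN
import Literature.Analysis.FunctionSpaces.TorusSpaceTime
import Summits.AtomisticToContinuum.HydrodynamicLimit.Theorems.ImplosionDichotomyHydroLimitInBandWindowContinuityFields
import HarnessLib

/-!
# The local collisional instance LC1 (stub `stub_localCollisionalInstance`, line `IdeatorTwoSketch`,
# crux `ClampedCurrentsDock`, stmt-AtomisticToContinuum-14680)

Helper file (`--supports stmt-AtomisticToContinuum-14680`) proving the registered stub
`stub_localCollisionalInstance : LocalCollisionalInstance` (LC1) of the lead's skeleton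
(`Cruxes/ClampedCurrentsDock/Lines/IdeatorTwoSketch.lean`, §1d): the local clamped collisional-transfer
window LD along families (`LocalClampedTransferWindowLDFamily`, the hypothesis) applied at the four
test-function families of the relative-entropy ledger, `φ_k = u₀_k/θ₀` (momentum row `k` of its own
instance, `k = 0, 1, 2`) and `φ_e = −θ₀⁻¹` (energy row of its instance), for globally jointly continuous
positive reference families with `θ₀, u₀` jointly smooth on the slab `[0, t₁] × 𝕋³`.

Proof (docstring of `LocalCollisionalInstance`): `ηC := η₀`; the four test families are jointly smooth on
the slab (quotient, resp. negative inverse, of jointly smooth families with positive denominator: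
`ContDiffOn.div/inv/neg` on the space–time lift `Torus.stLift`); four applications of the hypothesis;
the thresholds combine as `V₀ := max`, `β₀ := min`, `τ₀ := max`, `N₀ := max` (the abstract plumbing
lemma `frame_and`, applied three times, and `frame_mono`); at `N ≥ N₀`, `s ∈ [0, t₁]` one reads off
row `k` of instance `k` and the energy row of instance `e` (definitionally the stated bounds).
-/

noncomputable section

namespace Summit.AtomisticToContinuum.HydrodynamicLimit.Theorems.ClampedCurrentsDockLocalInstance

open scoped BigOperators ENNReal Classical Interval
open MeasureTheory Filter Set Topology InformationTheory
open Literature.MathematicalPhysics.KineticTheory Literature.Analysis.FluidPDE Literature.Analysis.FunctionSpaces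
open Summit.AtomisticToContinuum.HydrodynamicLimit.Theses.OneFlightGossipEngine
open Summit.AtomisticToContinuum.HydrodynamicLimit.Theorems

/-! ## The statements (verbatim from the registered skeleton) -/

/-- registered stub signature (the hypothesis of LC1: the local clamped collisional-transfer window LD along
families) of line IdeatorTwoSketch, crux ClampedCurrentsDock — route-internal, not a cited fact -/
def LocalClampedTransferWindowLDFamily : Prop :=
  ∃ η₀ : ℝ, 0 < η₀ ∧ ∀ (t₁ : ℝ) (a θ₀ : ℝ → T3 → ℝ) (u₀ : ℝ → T3 → V3) (ha : ∀ s, Continuous (a s)),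
    Continuous (Function.uncurry a) → Continuous (Function.uncurry θ₀) → Continuous (Function.uncurry u₀) →
    ∀ (ha0 : ∀ s x, 0 < a s x), (∀ s x, 0 < θ₀ s x) → ∀ σ : ℝ, 0 < σ → σ < 1 / 2 →
    (∀ s ∈ Set.Icc 0 t₁, σ ^ 3 * (⨆ x, a s x) ≤ η₀ * ∫ x, a s x) →
    ∀ Φ : (N : ℕ) → HardSphereFlow (Torus.geometry (Fin 3)) (hsDiameter σ N) (N + 1),
    ∀ φ : ℝ → T3 → ℝ, Torus.IsSmoothSpaceTimeOn (Set.Icc 0 t₁) φ →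
    ∃ V₀ : ℝ, 0 < V₀ ∧ ∀ V : ℝ, V₀ ≤ V → ∃ β₀ : ℝ, 0 < β₀ ∧ ∀ β : ℝ, |β| ≤ β₀ → ∀ ε : ℝ, 0 < ε →
    ∃ τ₀ : ℝ, 0 < τ₀ ∧ ∀ τ : ℝ, τ₀ ≤ τ → ∃ N₀ : ℕ, ∀ N : ℕ, N₀ ≤ N → ∀ s ∈ Set.Icc 0 t₁,
      (let ρ₀ : T3 → ℝ := rhoLim (profileOf (a s) (ha s) (ha0 s)) σ
       let w : ℝ := τ * ((N : ℝ) + 1) ^ (-(1 / 3 : ℝ))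
       let P := localGibbsLaw σ (a s) (u₀ s) (θ₀ s) N (Φ N)
       let Z : T3 → ℝ := fun x => hsCompressibility (ρ₀ x * σ ^ 3)
       let Z' : T3 → ℝ := fun x => deriv hsCompressibility (ρ₀ x * σ ^ 3)
       let act := fun (i : Fin (N + 1)) (z : Config (N + 1) (Fin 3) T3) =>
         σ / τ * (Φ N).collisionSum (Set.Ioc 0 w) (fun c => if c.fst = i then
           ‖c.postVel.1 - c.preVel.1‖ + |‖c.postVel.1‖ ^ 2 - ‖c.preVel.1‖ ^ 2| / 2 else 0) z
       let ω := fun (i : Fin (N + 1)) (z : Config (N + 1) (Fin 3) T3) => if act i z ≤ V then (1 : ℝ) else 0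
       let Xm := fun (k : Fin 3) (z : Config (N + 1) (Fin 3) T3) =>
         (Φ N).collisionSum (Set.Ioc 0 w)
           (fun c => ω c.fst z * ω c.snd z * ((φ s c.fstPos - φ s c.sndPos) * (c.postVel.1 k - c.preVel.1 k)) / 2) z
       let Am := fun (k : Fin 3) (z : Config (N + 1) (Fin 3) T3) =>
         (∫ r in (0 : ℝ)..w, ∑ i : Fin (N + 1), Torus.partialDeriv k (φ s) ((Φ N).flow r z i).1 *
           (θ₀ s ((Φ N).flow r z i).1 * (ρ₀ ((Φ N).flow r z i).1 * σ ^ 3) * Z' ((Φ N).flow r z i).1 +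
             (1 / 3) * (Z ((Φ N).flow r z i).1 - 1) * ‖((Φ N).flow r z i).2 - u₀ s ((Φ N).flow r z i).1‖ ^ 2)) -
         w * ((N : ℝ) + 1) * ∫ x, ρ₀ x * Torus.partialDeriv k (φ s) x * (θ₀ s x * (ρ₀ x * σ ^ 3) * Z' x)
       let Xe := fun (z : Config (N + 1) (Fin 3) T3) =>
         (Φ N).collisionSum (Set.Ioc 0 w)
           (fun c => ω c.fst z * ω c.snd z *
             ((φ s c.fstPos - φ s c.sndPos) * ((‖c.postVel.1‖ ^ 2 - ‖c.preVel.1‖ ^ 2) / 2)) / 2) z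
       let Ae := fun (z : Config (N + 1) (Fin 3) T3) =>
         (∫ r in (0 : ℝ)..w, ∑ i : Fin (N + 1),
           ((∑ l : Fin 3, u₀ s ((Φ N).flow r z i).1 l * Torus.partialDeriv l (φ s) ((Φ N).flow r z i).1) *
               (θ₀ s ((Φ N).flow r z i).1 * (ρ₀ ((Φ N).flow r z i).1 * σ ^ 3) * Z' ((Φ N).flow r z i).1 +
                 (1 / 3) * (Z ((Φ N).flow r z i).1 - 1) * ‖((Φ N).flow r z i).2 - u₀ s ((Φ N).flow r z i).1‖ ^ 2) +
             θ₀ s ((Φ N).flow r z i).1 * (Z ((Φ N).flow r z i).1 - 1) *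
               (∑ l : Fin 3, Torus.partialDeriv l (φ s) ((Φ N).flow r z i).1 *
                 (((Φ N).flow r z i).2 - u₀ s ((Φ N).flow r z i).1) l))) -
         w * ((N : ℝ) + 1) *
           ∫ x, ρ₀ x * (∑ l : Fin 3, u₀ s x l * Torus.partialDeriv l (φ s) x) * (θ₀ s x * (ρ₀ x * σ ^ 3) * Z' x)
       (∀ k : Fin 3, ∫⁻ z, ENNReal.ofReal (Real.exp (β * (w⁻¹ * Xm k z - w⁻¹ * Am k z))) ∂P ≤
           ENNReal.ofReal (Real.exp (ε * ((N : ℝ) + 1)))) ∧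
         ∫⁻ z, ENNReal.ofReal (Real.exp (β * (w⁻¹ * Xe z - w⁻¹ * Ae z))) ∂P ≤
           ENNReal.ofReal (Real.exp (ε * ((N : ℝ) + 1))))

/-- registered stub signature (LC1, the local collisional instance: the hypothesis applied at the four
test-function families of the ledger) of line IdeatorTwoSketch, crux ClampedCurrentsDock — route-internal,
not a cited fact -/
def LocalCollisionalInstance : Prop :=
  LocalClampedTransferWindowLDFamily →
  ∃ ηC : ℝ, 0 < ηC ∧ ∀ (t₁ : ℝ) (a θ₀ : ℝ → T3 → ℝ) (u₀ : ℝ → T3 → V3) (ha : ∀ s, Continuous (a s)),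
    Continuous (Function.uncurry a) → Continuous (Function.uncurry θ₀) → Continuous (Function.uncurry u₀) →
    ∀ (ha0 : ∀ s x, 0 < a s x), (∀ s x, 0 < θ₀ s x) →
    Torus.IsSmoothSpaceTimeOn (Set.Icc 0 t₁) θ₀ → Torus.IsSmoothSpaceTimeOn (Set.Icc 0 t₁) u₀ →
    ∀ σ : ℝ, 0 < σ → σ < 1 / 2 →
    (∀ s ∈ Set.Icc 0 t₁, σ ^ 3 * (⨆ x, a s x) ≤ ηC * ∫ x, a s x) →
    ∀ Φ : (N : ℕ) → HardSphereFlow (Torus.geometry (Fin 3)) (hsDiameter σ N) (N + 1),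
    ∃ V₀ : ℝ, 0 < V₀ ∧ ∀ V : ℝ, V₀ ≤ V → ∃ β₀ : ℝ, 0 < β₀ ∧ ∀ β : ℝ, |β| ≤ β₀ → ∀ ε : ℝ, 0 < ε →
    ∃ τ₀ : ℝ, 0 < τ₀ ∧ ∀ τ : ℝ, τ₀ ≤ τ → ∃ N₀ : ℕ, ∀ N : ℕ, N₀ ≤ N → ∀ s ∈ Set.Icc 0 t₁,
      (let ρ₀ : T3 → ℝ := rhoLim (profileOf (a s) (ha s) (ha0 s)) σ
       let w : ℝ := τ * ((N : ℝ) + 1) ^ (-(1 / 3 : ℝ))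
       let P := localGibbsLaw σ (a s) (u₀ s) (θ₀ s) N (Φ N)
       let Z : T3 → ℝ := fun x => hsCompressibility (ρ₀ x * σ ^ 3)
       let Z' : T3 → ℝ := fun x => deriv hsCompressibility (ρ₀ x * σ ^ 3)
       let act := fun (i : Fin (N + 1)) (z : Config (N + 1) (Fin 3) T3) =>
         σ / τ * (Φ N).collisionSum (Set.Ioc 0 w) (fun c => if c.fst = i then
           ‖c.postVel.1 - c.preVel.1‖ + |‖c.postVel.1‖ ^ 2 - ‖c.preVel.1‖ ^ 2| / 2 else 0) z
       let ω := fun (i : Fin (N + 1)) (z : Config (N + 1) (Fin 3) T3) => if act i z ≤ V then (1 : ℝ) else 0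
       let Xm := fun (φ : T3 → ℝ) (k : Fin 3) (z : Config (N + 1) (Fin 3) T3) =>
         (Φ N).collisionSum (Set.Ioc 0 w)
           (fun c => ω c.fst z * ω c.snd z * ((φ c.fstPos - φ c.sndPos) * (c.postVel.1 k - c.preVel.1 k)) / 2) z
       let Am := fun (φ : T3 → ℝ) (k : Fin 3) (z : Config (N + 1) (Fin 3) T3) =>
         (∫ r in (0 : ℝ)..w, ∑ i : Fin (N + 1), Torus.partialDeriv k φ (((Φ N).flow r z i).1) *
           (θ₀ s (((Φ N).flow r z i).1) * (ρ₀ (((Φ N).flow r z i).1) * σ ^ 3) * Z' (((Φ N).flow r z i).1) +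
             (1 / 3) * (Z (((Φ N).flow r z i).1) - 1) * ‖(((Φ N).flow r z i).2) - u₀ s (((Φ N).flow r z i).1)‖ ^ 2)) -
         w * ((N : ℝ) + 1) * ∫ x, ρ₀ x * Torus.partialDeriv k φ x * (θ₀ s x * (ρ₀ x * σ ^ 3) * Z' x)
       let Xe := fun (φ : T3 → ℝ) (z : Config (N + 1) (Fin 3) T3) =>
         (Φ N).collisionSum (Set.Ioc 0 w)
           (fun c => ω c.fst z * ω c.snd z *
             ((φ c.fstPos - φ c.sndPos) * ((‖c.postVel.1‖ ^ 2 - ‖c.preVel.1‖ ^ 2) / 2)) / 2) z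
       let Ae := fun (φ : T3 → ℝ) (z : Config (N + 1) (Fin 3) T3) =>
         (∫ r in (0 : ℝ)..w, ∑ i : Fin (N + 1),
           ((∑ l : Fin 3, u₀ s (((Φ N).flow r z i).1) l * Torus.partialDeriv l φ (((Φ N).flow r z i).1)) *
               (θ₀ s (((Φ N).flow r z i).1) * (ρ₀ (((Φ N).flow r z i).1) * σ ^ 3) * Z' (((Φ N).flow r z i).1) +
                 (1 / 3) * (Z (((Φ N).flow r z i).1) - 1) *
                   ‖(((Φ N).flow r z i).2) - u₀ s (((Φ N).flow r z i).1)‖ ^ 2) +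
             θ₀ s (((Φ N).flow r z i).1) * (Z (((Φ N).flow r z i).1) - 1) *
               (∑ l : Fin 3, Torus.partialDeriv l φ (((Φ N).flow r z i).1) *
                 ((((Φ N).flow r z i).2) - u₀ s (((Φ N).flow r z i).1)) l))) -
         w * ((N : ℝ) + 1) *
           ∫ x, ρ₀ x * (∑ l : Fin 3, u₀ s x l * Torus.partialDeriv l φ x) * (θ₀ s x * (ρ₀ x * σ ^ 3) * Z' x)
       (∀ k : Fin 3, ∫⁻ z, ENNReal.ofReal (Real.exp (β *
           (w⁻¹ * Xm (fun x => u₀ s x k / θ₀ s x) k z - w⁻¹ * Am (fun x => u₀ s x k / θ₀ s x) k z))) ∂P ≤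
           ENNReal.ofReal (Real.exp (ε * ((N : ℝ) + 1)))) ∧
         ∫⁻ z, ENNReal.ofReal (Real.exp (β *
           (w⁻¹ * Xe (fun x => -(θ₀ s x)⁻¹) z - w⁻¹ * Ae (fun x => -(θ₀ s x)⁻¹) z))) ∂P ≤
           ENNReal.ofReal (Real.exp (ε * ((N : ℝ) + 1))))

/-! ## Quantifier plumbing: the threshold frame `∃ V₀ ∀ V ∃ β₀ ∀ β ∀ ε ∃ τ₀ ∀ τ ∃ N₀ ∀ N ∀ s ∈ [0, t₁]` -/

/-- Two statements in the threshold frame `∃ V₀ ∀ V ≥ V₀ ∃ β₀ ∀ |β| ≤ β₀ ∀ ε > 0 ∃ τ₀ ∀ τ ≥ τ₀ ∃ N₀ ∀ N ≥ N₀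
∀ s ∈ [0, t₁]` combine to their conjunction in the same frame (`V₀ := max`, `β₀ := min`, `τ₀ := max`,
`N₀ := max`). [folklore] -/
theorem frame_and {t₁ : ℝ} {P Q : ℝ → ℝ → ℝ → ℝ → ℕ → ℝ → Prop}
    (hP : ∃ V₀ : ℝ, 0 < V₀ ∧ ∀ V : ℝ, V₀ ≤ V → ∃ β₀ : ℝ, 0 < β₀ ∧ ∀ β : ℝ, |β| ≤ β₀ → ∀ ε : ℝ, 0 < ε →
      ∃ τ₀ : ℝ, 0 < τ₀ ∧ ∀ τ : ℝ, τ₀ ≤ τ → ∃ N₀ : ℕ, ∀ N : ℕ, N₀ ≤ N → ∀ s ∈ Set.Icc 0 t₁, P V β ε τ N s)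
    (hQ : ∃ V₀ : ℝ, 0 < V₀ ∧ ∀ V : ℝ, V₀ ≤ V → ∃ β₀ : ℝ, 0 < β₀ ∧ ∀ β : ℝ, |β| ≤ β₀ → ∀ ε : ℝ, 0 < ε →
      ∃ τ₀ : ℝ, 0 < τ₀ ∧ ∀ τ : ℝ, τ₀ ≤ τ → ∃ N₀ : ℕ, ∀ N : ℕ, N₀ ≤ N → ∀ s ∈ Set.Icc 0 t₁, Q V β ε τ N s) :
    ∃ V₀ : ℝ, 0 < V₀ ∧ ∀ V : ℝ, V₀ ≤ V → ∃ β₀ : ℝ, 0 < β₀ ∧ ∀ β : ℝ, |β| ≤ β₀ → ∀ ε : ℝ, 0 < ε →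
      ∃ τ₀ : ℝ, 0 < τ₀ ∧ ∀ τ : ℝ, τ₀ ≤ τ → ∃ N₀ : ℕ, ∀ N : ℕ, N₀ ≤ N → ∀ s ∈ Set.Icc 0 t₁,
        P V β ε τ N s ∧ Q V β ε τ N s := by
  obtain ⟨V₁, hV₁, hP⟩ := hP
  obtain ⟨V₂, -, hQ⟩ := hQ
  refine ⟨max V₁ V₂, lt_max_of_lt_left hV₁, fun V hV => ?_⟩
  obtain ⟨β₁, hβ₁, hP⟩ := hP V ((le_max_left _ _).trans hV)
  obtain ⟨β₂, hβ₂, hQ⟩ := hQ V ((le_max_right _ _).trans hV)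
  refine ⟨min β₁ β₂, lt_min hβ₁ hβ₂, fun β hβ ε hε => ?_⟩
  obtain ⟨τ₁, hτ₁, hP⟩ := hP β (hβ.trans (min_le_left _ _)) ε hε
  obtain ⟨τ₂, -, hQ⟩ := hQ β (hβ.trans (min_le_right _ _)) ε hε
  refine ⟨max τ₁ τ₂, lt_max_of_lt_left hτ₁, fun τ hτ => ?_⟩
  obtain ⟨N₁, hP⟩ := hP τ ((le_max_left _ _).trans hτ)
  obtain ⟨N₂, hQ⟩ := hQ τ ((le_max_right _ _).trans hτ)
  exact ⟨max N₁ N₂, fun N hN s hs =>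
    ⟨hP N ((le_max_left _ _).trans hN) s hs, hQ N ((le_max_right _ _).trans hN) s hs⟩⟩

/-- The threshold frame is monotone in the innermost statement. [folklore] -/
theorem frame_mono {t₁ : ℝ} {P Q : ℝ → ℝ → ℝ → ℝ → ℕ → ℝ → Prop}
    (hPQ : ∀ V β ε τ N s, P V β ε τ N s → Q V β ε τ N s)
    (hP : ∃ V₀ : ℝ, 0 < V₀ ∧ ∀ V : ℝ, V₀ ≤ V → ∃ β₀ : ℝ, 0 < β₀ ∧ ∀ β : ℝ, |β| ≤ β₀ → ∀ ε : ℝ, 0 < ε →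
      ∃ τ₀ : ℝ, 0 < τ₀ ∧ ∀ τ : ℝ, τ₀ ≤ τ → ∃ N₀ : ℕ, ∀ N : ℕ, N₀ ≤ N → ∀ s ∈ Set.Icc 0 t₁, P V β ε τ N s) :
    ∃ V₀ : ℝ, 0 < V₀ ∧ ∀ V : ℝ, V₀ ≤ V → ∃ β₀ : ℝ, 0 < β₀ ∧ ∀ β : ℝ, |β| ≤ β₀ → ∀ ε : ℝ, 0 < ε →
      ∃ τ₀ : ℝ, 0 < τ₀ ∧ ∀ τ : ℝ, τ₀ ≤ τ → ∃ N₀ : ℕ, ∀ N : ℕ, N₀ ≤ N → ∀ s ∈ Set.Icc 0 t₁, Q V β ε τ N s := by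
  obtain ⟨V₀, hV₀, hP⟩ := hP
  refine ⟨V₀, hV₀, fun V hV => ?_⟩
  obtain ⟨β₀, hβ₀, hP⟩ := hP V hV
  refine ⟨β₀, hβ₀, fun β hβ ε hε => ?_⟩
  obtain ⟨τ₀, hτ₀, hP⟩ := hP β hβ ε hε
  refine ⟨τ₀, hτ₀, fun τ hτ => ?_⟩
  obtain ⟨N₀, hP⟩ := hP τ hτ
  exact ⟨N₀, fun N hN s hs => hPQ V β ε τ N s (hP N hN s hs)⟩

/-- A `Fin 3`-indexed family of statements in the threshold frame combines to `∀ k` in the same frame.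
[folklore] -/
theorem frame_forall_fin {t₁ : ℝ} {P : Fin 3 → ℝ → ℝ → ℝ → ℝ → ℕ → ℝ → Prop}
    (hP : ∀ k, ∃ V₀ : ℝ, 0 < V₀ ∧ ∀ V : ℝ, V₀ ≤ V → ∃ β₀ : ℝ, 0 < β₀ ∧ ∀ β : ℝ, |β| ≤ β₀ → ∀ ε : ℝ, 0 < ε →
      ∃ τ₀ : ℝ, 0 < τ₀ ∧ ∀ τ : ℝ, τ₀ ≤ τ → ∃ N₀ : ℕ, ∀ N : ℕ, N₀ ≤ N → ∀ s ∈ Set.Icc 0 t₁, P k V β ε τ N s) :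
    ∃ V₀ : ℝ, 0 < V₀ ∧ ∀ V : ℝ, V₀ ≤ V → ∃ β₀ : ℝ, 0 < β₀ ∧ ∀ β : ℝ, |β| ≤ β₀ → ∀ ε : ℝ, 0 < ε →
      ∃ τ₀ : ℝ, 0 < τ₀ ∧ ∀ τ : ℝ, τ₀ ≤ τ → ∃ N₀ : ℕ, ∀ N : ℕ, N₀ ≤ N → ∀ s ∈ Set.Icc 0 t₁,
        ∀ k, P k V β ε τ N s := by
  refine frame_mono ?_ (frame_and (frame_and (hP 0) (hP 1)) (hP 2))
  rintro V β ε τ N s ⟨⟨h0, h1⟩, h2⟩ k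
  fin_cases k
  exacts [h0, h1, h2]

/-! ## LC1 -/

/-- **LC1, the local collisional instance**: `LocalClampedTransferWindowLDFamily` applied at the four
test-function families `φ_k = u₀_k/θ₀` (row `k` of its own instance) and `φ_e = −θ₀⁻¹` (energy row of its
instance), jointly smooth on the slab as quotient / negative inverse of jointly smooth families with positive
denominator; thresholds `V₀ := max`, `β₀ := min`, `τ₀ := max`, `N₀ := max`. [folklore] -/
theorem stub_localCollisionalInstance : LocalCollisionalInstance := by
  intro hH
  obtain ⟨η₀, hη₀, hH⟩ := hH
  refine ⟨η₀, hη₀, ?_⟩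
  intro t₁ a θ₀ u₀ ha hac hθc huc ha0 hθ0 hθs hus σ hσ hσ2 hdil Φ
  -- smoothness of the test families on the slab
  have hθ' : ∀ p ∈ Set.Icc (0 : ℝ) t₁ ×ˢ (univ : Set V3), Torus.stLift θ₀ p ≠ 0 := fun p _ =>
    (hθ0 p.1 (Torus.proj p.2)).ne'
  have hφ : ∀ k : Fin 3, Torus.IsSmoothSpaceTimeOn (Set.Icc 0 t₁) (fun s y => u₀ s y k / θ₀ s y) :=
    fun k => show ContDiffOn ℝ _ (fun p : ℝ × V3 => Torus.stLift u₀ p k / Torus.stLift θ₀ p)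
      (Set.Icc 0 t₁ ×ˢ univ) from ContDiffOn.div (hus.apply k) hθs hθ'
  have hφe : Torus.IsSmoothSpaceTimeOn (Set.Icc 0 t₁) (fun s y => -(θ₀ s y)⁻¹) :=
    show ContDiffOn ℝ _ (fun p : ℝ × V3 => -(Torus.stLift θ₀ p)⁻¹) (Set.Icc 0 t₁ ×ˢ univ) from
      (ContDiffOn.inv hθs hθ').neg
  -- the four instances of the hypothesis
  have hk := fun k : Fin 3 => hH t₁ a θ₀ u₀ ha hac hθc huc ha0 hθ0 σ hσ hσ2 hdil Φ _ (hφ k)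
  have he := hH t₁ a θ₀ u₀ ha hac hθc huc ha0 hθ0 σ hσ hσ2 hdil Φ _ hφe
  refine frame_mono ?_ (frame_and (frame_forall_fin hk) he)
  rintro V β ε τ N s ⟨hk', he'⟩
  exact ⟨fun k => (hk' k).1 k, he'.2⟩

end Summit.AtomisticToContinuum.HydrodynamicLimit.Theorems.ClampedCurrentsDockLocalInstance

end
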